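import Literature.MathematicalPhysics.QuantumFieldTheory.Balaban1983to89.B9Eq342GreenPrimeSupRowBlockRoad
import Literature.MathematicalPhysics.QuantumFieldTheory.Balaban1983to89.B11SupSize190
import Literature.MathematicalPhysics.QuantumFieldTheory.Balaban1983to89.B9Thm37GlueTorus

/-!
# `Balaban1983to89.Beta.RemainderHasMajGreenPrime` — T. Bałaban, *The variational problem and background fields in
# renormalization group method for lattice gauge theories*, Commun. Math. Phys. **102** (1985) 277–309 [Balaban1985Variational]
# = "[15]", Sect. G p. 306 (180) *«defining G̃ = (Δ_a − Δ⁽²⁾)⁻¹. From the estimate (3.137) it follows that Δ⁽²⁾ is a small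
# perturbation of Δ_a, and the new operator G̃ has exactly the same properties as Δ_a⁻¹»* and p. 308 (190), read against
# T. Bałaban, *Propagators for lattice gauge theories in a background field*, Commun. Math. Phys. **99** (1985) 389–434
# [Balaban1985BackgroundPropagators] = "[B9]", Thm 3.1 (3.42) p. 397 *«|(G′(U)λ)(x)| ≤ B₀(L^jη)²e^{−δ₀d(y,y′)}|λ| for x ∈ Δ(y),
# supp λ ⊂ Δ(y′)»*: **THE JUNCTION OF BINDER ROW (D4)'s NODE-D LETTER `hG` WITH THE NE9 CREW's (3.42)-IN-A-BACKGROUND-FIELD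
# THEOREM** — the block-road letter `B9Eq342GreenPrimeSupRowBlockRoad.exists_local_letter_GpOfU` (ne9-leaf-03) for print's `G′(U)`
# at one step, IN A BACKGROUND FIELD `U` of its window, re-typed BY NAME as a `B11SectG.HasMaj` block majorant between the sup
# sizes of (190) (`B11SupSize190.supSize`) over the one-scale torus of blocks (`B9Thm37GlueTorus.torusGeom` in its `B9Thm34Ext.toB6`
# repackaging — the geometry family of `Beta/RemainderRowSum` §5 and `Beta/RemainderDecay190TwoGridOrigin`), i.e. in the exact
# binder shape `HasMaj b3 bN (𝒢↾ℝ) (B_G·e^{−ρ·d})` of `Beta/RemainderChartOriginDerivative.ineq190_fderiv_chartH179_zero_of_letters`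

statement-level skeleton of published theorems with citation tags; proofs where landed; nothing here is a claim
about the Yang–Mills mass gap

CITATION HEADER (lean-in-tree rule).  Audit cell `pub-balaban`, BINDER row (D4) (`RemainderConst` leaves for Bałaban's
split), OWNER unit `b2b-balaban-beta-an4` gen 104.  [15] p. 297 (after (128)), p. 306 (180) and p. 308 (189)–(190) read this generation on
the held text `paper:balaban1985-cmp102-variational-background` pp. 21, 30–32 (journal page = PDF page + 276); [B9] (3.42) p. 397 quoted
from the header of `B9Eq342GreenPrimeSupRowBlockRoad` (its authors' render); "[3]" = T. Bałaban, *Propagators and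
renormalization transformations for lattice gauge theories. II*, Commun. Math. Phys. **96** (1984) 223–250
[Balaban1984PropagatorsII], (2.51)–(2.52) p. 232 (the sharp blocks and their partition of unity, typed as `BlockNorm.cut` ∕
`sum_cut` in `B11SectG` and as `B11SupSize190.pieceOf`).  Composed BY NAME: ne9-leaf-03's `exists_sup_row_GpOfU` and the lemmas behind its
`exists_local_letter_GpOfU` — ne9-leaf-06's `B9Eq349ConjugatedDPCircleClosed.coercive_of_canonical_diagonal`, ne9-leaf-01's
`B9Eq349ConjugatedGreenBlockDecay.norm_block_le_exp_of_uniform_circle_bound_sites` ∕ `norm_conjGp_le_of_circle` and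
`B9Eq349BlockMultipliers.exists_block_clm_family`, ne9-leaf-03's `B9Eq347LocalFromBlockDecay.local_of_block_decay_sites` (window binders
token for token) —, `B11SupSize190.supSize` ∕ `norm_apply_le_loc` ∕
`loc_le_of_forall` ∕ `supSize_isLoc_iff`, `B9Thm37GlueTorus.torusGeom` ∕ `tdist1`, `B5TorusCover.UT`.  NOTHING printed is
asserted: the window and the constant `B = C·e^{r}·√(L^d)` are the NE9 cell's; the identification of [15]'s `Δ_a` of (115)
at step `k` (and of `G̃ = (Δ_a − Δ⁽²⁾)⁻¹`) with the one-step operator `laplacePrimeA` ∕ `GpOfU` of the `B9Eq3119*` carrier is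
NOT made here (it is row (D4)'s NODE O — Bałaban's step objects as terms — ownerless and frozen, cell ruling (0)).

WHAT IS PROVED (sorry-free; proof lane — no `def`; [folklore] plumbing + composition by name).
§1 (any geometry `g`, any point set `X`, any normed `E`, sup sizes `supSize g box blk` whose boxes are the fibres of the
block map): **`hasMaj_supSize_of_local`** — a LOCAL LETTER *«f supported in the block of v, ‖f‖_∞ ≤ F ⟹ ‖(Tf)(x)‖ ≤
K(block of x, v)·F»* with `K ≥ 0` IS `HasMaj (supSize …) (supSize …) T K`; **`hasMaj_supSize_const_of_sup`** — an
`L^∞ → L^∞` row *«‖f‖_∞ ≤ F ⟹ ‖(Tf)(x)‖ ≤ B₀F»* IS the constant majorant `HasMaj … T (fun _ _ => B₀)`.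
§2 (the one-scale torus of blocks `UT m` in `toB6 (torusGeom m η₀ L₀ M₀) R H`, fine sites `TSite d (fineP L m)`, block map
`blockCoord L m`, values in `W`; print's `G′(U)` of the NE9 carrier conjugated to plain functions by `WL2.linearEquiv`, read over `ℝ`;
ne9-leaf-03's window binders token for token, the torus `m` quantified AFTER the constant): **`exists_local_letter_GpOfU_uniform`** —
ne9-leaf-03's local letter with ONE `B = 4∕γ·e^{r}·√(L^d)` for EVERY torus `m` (their `exists_block_decay_Gp` fixes `m` before `∃ C`
although its witness `4∕γ` is volume-free; re-assembled by name from the same three lemmas); **`exists_hasMaj_GpOfU_uniform_sup`** —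
`∃ B ≥ 0, ∀ m, ∀ U` in the window: `HasMaj S_m S_m (G′(U)↾ℝ) (B·e^{−r·d_∞(y,v)})` (`d_∞` = the sup torus distance `tdist m` of the
blocks); **`exists_hasMaj_GpOfU_uniform`** — the same with the kernel `B·e^{−(r/d)·d_m(y,v)}` in the geometry's OWN distance
`d_m = (toB6 (torusGeom m η₀ L₀ M₀) R H).dist = tdist1 m` (the ℓ¹ torus distance; `d₁ ≤ d·d_∞`) and the operator packaged as
`(𝒢.restrictScalars ℝ : 𝒴 →ₗ[ℝ] 𝒴)` for the continuous linear map `𝒢 := LinearMap.toContinuousLinearMap (e ∘ G′(U) ∘ e⁻¹)` of the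
Banach space `𝒴 := TSite d (fineP L m) → W` — LITERALLY the shape `fun y y' => B_G * Real.exp (-(ρ * g.dist y y'))` consumed by
`B11SectG.hasMaj_comp_exp` and, token for token, the `hG` binder of `Beta/RemainderChartOriginDerivative.ineq190_fderiv_chartH179_zero_of_letters`
∕ `Beta/RemainderDecay190TwoGridOrigin.exists_data190_twoGrid_origin_of_letters` (`𝒵 = 𝒴`, `b3 = bN = S_m`, `B_G = B`, `δ₀ = r/d`),
with the volume-uniformity a `Data190` ∕ `Consts190` record reads over its torus sequence.
§3 (one torus `m`): **`exists_hasMaj_GpOfU`** — the instance of §2 at fixed `m`; **`exists_hasMaj_GpOfU_const`** (`0 < r`) —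
(3.47)'s row `|G′(U)λ|_∞ ≤ B₀|λ|_∞` as the constant majorant `fun _ _ => B₀`, from ne9-leaf-03's `exists_sup_row_GpOfU` by name.

HONEST SCOPE.  ONE letter of row (D4)'s NODE-D list (`hG`-shape) inhabited IN A BACKGROUND FIELD by a tree theorem instead of a
hypothesis — at ONE step (`j ≡ 0`), with the block road's `L`-dependent constant (`√(L^d)` inside `B`; print: «B₀ depends on d
and L only»), at the NE9 cell's rate `r` of its window (not print's `δ₀`), on the NE9 carrier (not on the two-grid carrier of
`Beta/RemainderDecay190TwoGrid*`, whose operators are scalar-valued model operators).  WHICH OPERATOR: [15] p. 297 after (128)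
*«Δ_a = Δ + DRD* + Q*aQ (the constant a = 1). For the operator Δ_a⁻¹ = G we have proved Theorem 3.3 in [5], and especially the
bounds (3.42)»* — so the `G̃ = (Δ_a − Δ⁽²⁾)⁻¹` of (180) is [B9] THEOREM 3.3's `G(U)` (gauge-fixing term `DRD*`, `a = 1`) perturbed
by `Δ⁽²⁾` — an operator on BOND functions («λ replaced by a function J defined at bonds», Thm 3.3 p. 399) —, whereas the operator
inhabited here is [B9] THEOREM 3.1's `G′(U) = (Δ^η_U + a′Q′*Q′)⁻¹` of the NE9 carrier, on SITE functions (no `DRD*`; print states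
Thm 3.3 «under the assumptions of Theorem 3.1, and with the constants described there» after (3.48)–(3.49) pp. 398–399 and proves
Thms 3.1–3.3 alike by the random-walk expansion of Sect. D): the junction is at the level of the SHAPE of (3.42) — Thm 3.3's
BOND propagator in a background, the `Δ⁽²⁾`-Neumann series of (180) («Δ⁽²⁾ is a small perturbation of Δ_a», (3.137)), and the
identification of the step-`k` objects with the one-step ones are NOT supplied here (NODE O ∕ the NE9 programme).  NOT the letters
`hH0` ([15] (129): *«H₀B … satisfies the bound (3.133) [5]»*) or `hD2H0` ((3.137)); NOT the step-`k`, `L^jη`-weighted sizes of (190);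
NOT k-uniform; NOT Thm 3.1 as printed (random-walk expansion, no window); NOT an instance of
`Data190` ∕ `ChainTFac190` (row (D4): instance 0∕1, D4 DISCHARGE NO DATE); NOT B12 Thm 2, NOT BetaPertH, NOT continuum, NOT
Clay.  HONEST DEPENDENCY (verbatim in every brief): continuum YM on T⁴ ⇐ BetaPertH ∧ nine spine estimates (0/9 proved);
BetaPertH ⇐ (D1) ∧ (D4) ∧ CAP+tail; G-an2-4 gates asym, D1 and NE2/3/4.  NEW file; imports `B9Eq342GreenPrimeSupRowBlockRoad`,
`B11SupSize190`, `B9Thm37GlueTorus` (all built); nothing modified.  Net new unproved facts: 0.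
-/

noncomputable section

open scoped BigOperators InnerProductSpace

namespace Literature.MathematicalPhysics.QuantumFieldTheory.Balaban1983to89.Beta.RemainderHasMajGreenPrime

open B11SectG B11SupSize190
open B4Sect5Torus (TSite tdist ccoord tdist_nonneg)
open B5TorusCover (UT)
open B9Thm34Ext (toB6)
open B9Thm37GlueTorus (torusGeom tdist1)
open B9SectCLatticeCarrier (Bond)
open B9Eq311L2Pairing (WL2)
open B9Eq319QprimeTorus (fineP blockCoord)
open B9Eq310HessianOperator (adTransportW)
open B11Eq103H1Complex (SiteL2K)
open B9Eq3119DeltaPiCarrier (laplacePrimeA GpOfU)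
open B9Thm311DeltaPrimeA (laplacePrimeA_pos_of_hRS)
open B7Prop1Explicit (U1)
open B9Eq342GreenPrimeSupRowBlockRoad (exists_local_letter_GpOfU exists_sup_row_GpOfU)
open B9Eq349ConjugatedDPCircleClosed (coercive_of_canonical_diagonal)
open B9Eq349ConjugatedGreenBlockDecay (norm_block_le_exp_of_uniform_circle_bound_sites norm_conjGp_le_of_circle)
open B9Eq349BlockMultipliers (exists_block_clm_family)
open B9Eq347LocalFromBlockDecay (local_of_block_decay_sites)

/-! ## §1  A local letter IS a block majorant for the sup sizes of (190) -/

section Local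

variable {g : B6.Geometry} {X : Type} {E : Type} [NormedAddCommGroup E] [Module ℝ E]
  {box : g.Site → Finset X} {blk : X → g.Site}

/-- **A LOCAL LETTER IS A BLOCK MAJORANT.**  For the sup sizes of (190) (`supSize g box blk`, boxes = the fibres of the block
map: `x ∈ box y ↔ blk x = y`), an `ℝ`-linear `T` on `X → E` and a kernel `K ≥ 0`: if for every block `v`, every `f` vanishing
off the block of `v` with `‖f(x)‖ ≤ F` everywhere, and every point `x`, `‖(Tf)(x)‖ ≤ K(blk x, v)·F`, then `HasMaj (supSize …)
(supSize …) T K` — *«(size of Tμ near y) ≤ K(y,y′)·(size of μ), μ localised near y′»*, [3] (2.51)–(2.52) with the sharp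
blocks (κ = 1).  Take `F :=` the size of `μ` at its block: points of the block are dominated by it (`norm_apply_le_loc`), points
off the block carry `μ = 0`. [cite: Balaban1984PropagatorsII, (2.51)–(2.52) p.232] [cite: Balaban1985Variational, (190) p.308] -/
theorem hasMaj_supSize_of_local (hbox : ∀ y x, x ∈ box y ↔ blk x = y) (T : (X → E) →ₗ[ℝ] (X → E))
    {K : g.Site → g.Site → ℝ} (hK : ∀ y y', 0 ≤ K y y')
    (hloc : ∀ (v : g.Site) (f : X → E) (F : ℝ), (∀ x, blk x ≠ v → f x = 0) → (∀ x, ‖f x‖ ≤ F) →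
      ∀ x, ‖T f x‖ ≤ K (blk x) v * F) :
    HasMaj (supSize g box blk) (supSize g box blk) T K := by
  intro v μ hμ y
  set F : ℝ := (supSize g box blk : BlockNorm g (X → E)).loc v μ with hF
  have hF0 : 0 ≤ F := (supSize g box blk : BlockNorm g (X → E)).loc_nonneg v μ
  have hμv : ∀ x, blk x ≠ v → μ x = 0 := (supSize_isLoc_iff v μ).1 hμ
  have hμF : ∀ x, ‖μ x‖ ≤ F := fun x => by
    by_cases hx : blk x = v
    · exact norm_apply_le_loc ((hbox v x).2 hx) μ
    · rw [hμv x hx, norm_zero]; exact hF0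
  refine loc_le_of_forall (mul_nonneg (hK y v) hF0) fun x hx => ?_
  have h := hloc v μ F hμv hμF x
  rwa [(hbox y x).1 hx] at h

/-- **AN `L^∞ → L^∞` ROW IS A CONSTANT MAJORANT**: if `‖f(x)‖ ≤ F` everywhere implies `‖(Tf)(x)‖ ≤ B₀·F` everywhere (`B₀ ≥ 0`),
then `HasMaj (supSize …) (supSize …) T (fun _ _ => B₀)` — the shape of (3.47) *«|G′(U)λ| ≤ B₀|λ|»* in `B11SectG` currency
(the constant majorants of `B11SectG.hasMaj_comp_const`). [cite: Balaban1985BackgroundPropagators, (3.47) p.398] [cite: Balaban1984PropagatorsII, (2.51)–(2.52) p.232] -/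
theorem hasMaj_supSize_const_of_sup (hbox : ∀ y x, x ∈ box y ↔ blk x = y) (T : (X → E) →ₗ[ℝ] (X → E))
    {B₀ : ℝ} (hB₀ : 0 ≤ B₀)
    (hsup : ∀ (f : X → E) (F : ℝ), (∀ x, ‖f x‖ ≤ F) → ∀ x, ‖T f x‖ ≤ B₀ * F) :
    HasMaj (supSize g box blk) (supSize g box blk) T (fun _ _ => B₀) :=
  hasMaj_supSize_of_local hbox T (fun _ _ => hB₀) fun _ f F _ hfF x => hsup f F hfF x

end Local

/-! ### Torus bookkeeping (the block torus `UT m`, its boxes, `d₁ ≤ d·d_∞`) -/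

section Aux

variable {d : ℕ} {m : Fin d → ℕ}

/-- `ofSite a = y ↔ a = toSite y` (both maps are the identity of the carrier). [folklore] -/
private theorem ofSite_eq_iff (a : TSite d m) (y : UT m) : UT.ofSite m a = y ↔ a = UT.toSite m y := by
  constructor
  · rintro rfl; rfl
  · rintro rfl; rfl

/-- The boxes of the block map are its fibres. [folklore] -/
private theorem mem_box_iff {L : ℕ} (y : UT m) (x : TSite d (fineP L m)) :
    x ∈ (Finset.univ.filter fun x : TSite d (fineP L m) => blockCoord L m x = UT.toSite m y) ↔
      UT.ofSite m (blockCoord L m x) = y := by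
  rw [Finset.mem_filter, ofSite_eq_iff]
  simp

variable [∀ i, NeZero (m i)]

/-- `d₁ ≤ d·d_∞` on the torus of blocks (a sum of `d` coordinate distances against their maximum). [folklore] -/
private theorem tdist1_le_mul_tdist (y v : UT m) :
    tdist1 m y v ≤ d * tdist m (UT.toSite m y) (UT.toSite m v) := by
  unfold tdist1 tdist
  have h : ∀ i ∈ (Finset.univ : Finset (Fin d)),
      ((ccoord m (UT.toSite m y) (UT.toSite m v) i : ℕ) : ℝ) ≤
        ((Finset.univ.sup (ccoord m (UT.toSite m y) (UT.toSite m v)) : ℕ) : ℝ) :=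
    fun i hi => by exact_mod_cast Finset.le_sup (f := ccoord m (UT.toSite m y) (UT.toSite m v)) hi
  calc ∑ i, ((ccoord m (UT.toSite m y) (UT.toSite m v) i : ℕ) : ℝ)
      ≤ ∑ _i : Fin d, ((Finset.univ.sup (ccoord m (UT.toSite m y) (UT.toSite m v)) : ℕ) : ℝ) :=
        Finset.sum_le_sum h
    _ = d * ((Finset.univ.sup (ccoord m (UT.toSite m y) (UT.toSite m v)) : ℕ) : ℝ) := by
        rw [Finset.sum_const, Finset.card_univ, Fintype.card_fin, nsmul_eq_mul]

/-- Rate bookkeeping `d_∞ ≥ d₁/d`: `e^{−r·d_∞} ≤ e^{−(r/d)·d₁}` for `r ≥ 0`. [folklore] -/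
private theorem exp_tdist_le_exp_tdist1 {r : ℝ} (hr : 0 ≤ r) (y v : UT m) :
    Real.exp (-(r * tdist m (UT.toSite m y) (UT.toSite m v))) ≤ Real.exp (-(r / d * tdist1 m y v)) := by
  refine Real.exp_le_exp.mpr (neg_le_neg ?_)
  have h1 := tdist1_le_mul_tdist y v
  have ht : 0 ≤ tdist m (UT.toSite m y) (UT.toSite m v) := tdist_nonneg _ _ _
  rcases Nat.eq_zero_or_pos d with hd | hd
  · subst hd
    simp only [Nat.cast_zero, div_zero, zero_mul]
    exact mul_nonneg hr ht
  · have hd' : (0 : ℝ) < d := by exact_mod_cast hd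
    calc r / d * tdist1 m y v ≤ r / d * (d * tdist m (UT.toSite m y) (UT.toSite m v)) :=
          mul_le_mul_of_nonneg_left h1 (div_nonneg hr hd'.le)
      _ = r * tdist m (UT.toSite m y) (UT.toSite m v) := by
          field_simp

end Aux

/-! ## §2  The one-scale torus of blocks, ONE constant for ALL tori and ALL backgrounds of the window (ne9-leaf-01∕03's witness `4∕γ·e^{r}·√(L^d)` is volume-free) -/

section Uniform

variable {d : ℕ} {L : ℕ} [NeZero L]
  {𝔸 : Type*} [NormedRing 𝔸] [NormedAlgebra ℂ 𝔸] [NormOneClass 𝔸]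
  {W : Type} [NormedAddCommGroup W] [InnerProductSpace ℂ W] [FiniteDimensional ℂ W] {φ : W ≃ₗ[ℂ] 𝔸} {Mφ Mφ' : ℝ}
  (hφ : ∀ w, ‖φ w‖ ≤ Mφ * ‖w‖) (hφ' : ∀ X, ‖φ.symm X‖ ≤ Mφ' * ‖X‖) (hMφ : 0 ≤ Mφ) (hMφ' : 0 ≤ Mφ')
  {c₀ : ℝ} [Fact (0 < c₀)] {η : ℝ} (hη : 0 < η) {εU : ℝ} (hεU : 0 ≤ εU)
  {c₁ : ℝ} [Fact (0 < c₁)] (hc : c₁ = (L : ℝ) ^ d * c₀) {a' : ℝ} (ha' : 0 < a') (hηL : η * L = 1)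
  (η₀ L₀ M₀ R : ℝ) (H : Prop)

include hφ hφ' hMφ hMφ' hη hεU hc ha' hηL in
/-- **ne9-leaf-03's LOCAL LETTER WITH THE TORUS QUANTIFIED AFTER THE CONSTANT** — `∃ B ≥ 0, ∀ m, ∀ U, …`: ne9-leaf-01's
`exists_block_decay_Gp` fixes the coarse torus `m` before `∃ C` although its witness `C = 4∕γ` is volume-free; re-assembled here BY
NAME from the same three lemmas (`coercive_of_canonical_diagonal`, `norm_block_le_exp_of_uniform_circle_bound_sites`,
`norm_conjGp_le_of_circle`) and `local_of_block_decay_sites` with the explicit witness `B = 4∕γ·e^{r}·√(L^d)`, so that ONE constant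
serves EVERY volume — the uniformity a `Data190`∕`Consts190` record of row (D4) reads over its torus sequence.
[cite: Balaban1985BackgroundPropagators, Thm 3.1 (3.42) p.397 «the constant B₀ depends on d and L only», (3.49) p.399, Thm 3.11 p.416] -/
theorem exists_local_letter_GpOfU_uniform {γ β r : ℝ} (hγ : 0 < γ) (hβ : 0 ≤ β) (hr : 0 ≤ r)
    (hγc : γ ≤ 1 / (2 + 2 / a') -
        (Real.sqrt d * (‖((η : ℂ))⁻¹‖ * (2 * Mφ * Mφ' * εU)) + (Real.sqrt d * (‖((η : ℂ))⁻¹‖ * (2 * Mφ * Mφ' * εU))) ^ 2 +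
          a' * (((1 + 2 * Mφ * Mφ' * εU) ^ (d * (L - 1)) - 1)) * (2 + ((1 + 2 * Mφ * Mφ' * εU) ^ (d * (L - 1)) - 1))))
    {ℓ ℓ' : ℝ} (hℓ : 1 ≤ ℓ) (hℓ' : 1 ≤ ℓ') (hwin : r * ℓ * η ≤ 1) (hwin' : r * ℓ' ≤ 1)
    (hβD : 2 * r * ℓ * (Mφ * Mφ') * Real.sqrt d ≤ β) (hβQ : 2 * r * ℓ' * (1 + 2 * Mφ * Mφ' * εU) ^ (d * (L - 1)) ≤ β)
    (small : 3 * (1 + a') * β ^ 2 ≤ γ / 4) (hL : 1 ≤ L) :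
    ∃ B : ℝ, 0 ≤ B ∧ ∀ (m : Fin d → ℕ) (hm : ∀ i, 1 ≤ m i) (U : Bond d (fineP L m) → 𝔸ˣ) (hU : ∀ b, U b ∈ U1 𝔸)
      (hUε : ∀ b, ‖(U b : 𝔸) - 1‖ ≤ εU)
      (hRS : ∀ (b : Bond d (fineP L m)) (v u : W), ⟪adTransportW φ U b v, u⟫_ℂ = ⟪v, adTransportW φ (fun b => (U b)⁻¹) b u⟫_ℂ)
      (v : TSite d m) (f : SiteL2K ℂ d (fineP L m) c₀ W) (F : ℝ),
      (∀ y, blockCoord L m y ≠ v → WL2.equiv ℂ (fun _ : TSite d (fineP L m) => c₀) W f y = 0) →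
      (∀ y, ‖WL2.equiv ℂ (fun _ : TSite d (fineP L m) => c₀) W f y‖ ≤ F) →
      ∀ x : TSite d (fineP L m),
        ‖WL2.equiv ℂ (fun _ : TSite d (fineP L m) => c₀) W
            (GpOfU L m φ η U a' (c₁ := c₁) (fun x hx => laplacePrimeA_pos_of_hRS L m φ η U a' hη.ne' ha' hRS x hx) f) x‖ ≤
          B * Real.exp (-(r * tdist m (blockCoord L m x) v)) * F := by
  refine ⟨4 / γ * Real.exp r * Real.sqrt ((L : ℝ) ^ d), by positivity, fun m hm U hU hUε hRS v f F hfv hfF x => ?_⟩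
  classical
  obtain ⟨PS, hPS⟩ := exists_block_clm_family (𝕜 := ℂ) (w := fun _ : TSite d (fineP L m) => c₀) (V := W) (blockCoord L m)
  have hL0 : (0 : ℝ) < L := by exact_mod_cast (show 0 < L by omega)
  have hι : 1 / (L : ℝ) ≤ ℓ * η := by
    rw [div_le_iff₀ hL0]
    calc (1 : ℝ) = 1 * (η * L) := by rw [hηL, mul_one]
      _ ≤ ℓ * (η * L) := by gcongr
      _ = ℓ * η * L := by ring
  have coercive := coercive_of_canonical_diagonal hφ hφ' hMφ hMφ' hU hεU hUε hc ha' hRS hηL hγ hγc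
  have hC : ∀ y₀ y₁ : TSite d m,
      ‖PS y₁ ∘L LinearMap.toContinuousLinearMap (GpOfU L m φ η U a' (c₁ := c₁)
          (fun x hx => laplacePrimeA_pos_of_hRS L m φ η U a' hη.ne' ha' hRS x hx)) ∘L PS y₀‖ ≤
        4 / γ * Real.exp r * Real.exp (-(r * tdist m y₀ y₁)) :=
    norm_block_le_exp_of_uniform_circle_bound_sites hm _ hPS hr (by positivity) hι hℓ'
      (fun χ χ' hχ hχ' MS hMS κ hκr => norm_conjGp_le_of_circle hφ hφ' hMφ hMφ' hη hU hεU hUε hc ha'.le hRS _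
        (zero_le_one.trans hℓ) (zero_le_one.trans hℓ') hχ hχ' hMS hγ hβ coercive hwin hwin' hβD hβQ small κ hκr)
  exact local_of_block_decay_sites hm
    (LinearMap.toContinuousLinearMap
      (GpOfU L m φ η U a' (c₁ := c₁) (fun x hx => laplacePrimeA_pos_of_hRS L m φ η U a' hη.ne' ha' hRS x hx)))
    hPS hPS (C := 4 / γ * Real.exp r) (by positivity) (fun v y => hC v y) v f F hfv hfF x

include hφ hφ' hMφ hMφ' hη hεU hc ha' hηL in
/-- **THE `hG`-SHAPED LETTER OF PRINT's `G′(U)` IN A BACKGROUND FIELD, sup-metric kernel, ONE constant for every volume.**  On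
ne9-leaf-03's window (binders token for token; the torus `m` quantified AFTER the constant, `1 ≤ m i` supplied by `NeZero`) there is ONE
`B ≥ 0` (`4∕γ·e^{r}·√(L^d)`) such that for EVERY coarse torus `m` and EVERY background `U` of the window on it, the operator `G′(U)` of
the `B9Eq3119*` carrier — conjugated to plain `W`-valued functions on the fine torus by `WL2.linearEquiv` and read over `ℝ` — has the
block majorant `B·e^{−r·d_∞(y,v)}` between the sup sizes of (190) over the torus of blocks `UT m` (`d_∞ = tdist m`; boxes = the fibres of
`blockCoord L m`): `HasMaj S_m S_m (G′(U)↾ℝ) (B·e^{−r·d_∞})` — [B9] (3.42)'s first entry at one step in `B11SectG` currency, the shape of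
the `G̃`-letter `hG` of (180)∕(190).
[cite: Balaban1985BackgroundPropagators, Thm 3.1 (3.42) p.397] [cite: Balaban1985Variational, (180) p.306, (190) p.308] [cite: Balaban1984PropagatorsII, (2.51)–(2.52) p.232] -/
theorem exists_hasMaj_GpOfU_uniform_sup {γ β r : ℝ} (hγ : 0 < γ) (hβ : 0 ≤ β) (hr : 0 ≤ r)
    (hγc : γ ≤ 1 / (2 + 2 / a') -
        (Real.sqrt d * (‖((η : ℂ))⁻¹‖ * (2 * Mφ * Mφ' * εU)) + (Real.sqrt d * (‖((η : ℂ))⁻¹‖ * (2 * Mφ * Mφ' * εU))) ^ 2 +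
          a' * (((1 + 2 * Mφ * Mφ' * εU) ^ (d * (L - 1)) - 1)) * (2 + ((1 + 2 * Mφ * Mφ' * εU) ^ (d * (L - 1)) - 1))))
    {ℓ ℓ' : ℝ} (hℓ : 1 ≤ ℓ) (hℓ' : 1 ≤ ℓ') (hwin : r * ℓ * η ≤ 1) (hwin' : r * ℓ' ≤ 1)
    (hβD : 2 * r * ℓ * (Mφ * Mφ') * Real.sqrt d ≤ β) (hβQ : 2 * r * ℓ' * (1 + 2 * Mφ * Mφ' * εU) ^ (d * (L - 1)) ≤ β)
    (small : 3 * (1 + a') * β ^ 2 ≤ γ / 4) (hL : 1 ≤ L) :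
    ∃ B : ℝ, 0 ≤ B ∧ ∀ (m : Fin d → ℕ) [∀ i, NeZero (m i)] (U : Bond d (fineP L m) → 𝔸ˣ) (hU : ∀ b, U b ∈ U1 𝔸)
      (hUε : ∀ b, ‖(U b : 𝔸) - 1‖ ≤ εU)
      (hRS : ∀ (b : Bond d (fineP L m)) (v u : W), ⟪adTransportW φ U b v, u⟫_ℂ = ⟪v, adTransportW φ (fun b => (U b)⁻¹) b u⟫_ℂ),
      HasMaj
        (supSize (toB6 (torusGeom m η₀ L₀ M₀) R H)
          (fun y => Finset.univ.filter fun x : TSite d (fineP L m) => blockCoord L m x = UT.toSite m y)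
          (fun x => UT.ofSite m (blockCoord L m x)) : BlockNorm (toB6 (torusGeom m η₀ L₀ M₀) R H) (TSite d (fineP L m) → W))
        (supSize (toB6 (torusGeom m η₀ L₀ M₀) R H)
          (fun y => Finset.univ.filter fun x : TSite d (fineP L m) => blockCoord L m x = UT.toSite m y)
          (fun x => UT.ofSite m (blockCoord L m x)))
        (((WL2.linearEquiv ℂ ℂ (fun _ : TSite d (fineP L m) => c₀) :
              SiteL2K ℂ d (fineP L m) c₀ W ≃ₗ[ℂ] (TSite d (fineP L m) → W)).toLinearMap ∘ₗ
            GpOfU L m φ η U a' (c₁ := c₁) (fun x hx => laplacePrimeA_pos_of_hRS L m φ η U a' hη.ne' ha' hRS x hx) ∘ₗ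
            (WL2.linearEquiv ℂ ℂ (fun _ : TSite d (fineP L m) => c₀) :
              SiteL2K ℂ d (fineP L m) c₀ W ≃ₗ[ℂ] (TSite d (fineP L m) → W)).symm.toLinearMap).restrictScalars ℝ)
        (fun y v => B * Real.exp (-(r * tdist m (UT.toSite m y) (UT.toSite m v)))) := by
  obtain ⟨B, hB0, hB⟩ :=
    exists_local_letter_GpOfU_uniform hφ hφ' hMφ hMφ' hη hεU hc ha' hηL hγ hβ hr hγc hℓ hℓ' hwin hwin' hβD hβQ small hL
  refine ⟨B, hB0, fun m _ U hU hUε hRS => ?_⟩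
  refine hasMaj_supSize_of_local (fun y x => mem_box_iff y x) _ (fun y v => by positivity) ?_
  intro v f F hfv hfF x
  -- the letter for the carrier element `e⁻¹ f`, whose values are those of `f`
  have hfv' : ∀ y, blockCoord L m y ≠ UT.toSite m v →
      WL2.equiv ℂ (fun _ : TSite d (fineP L m) => c₀) W
        ((WL2.linearEquiv ℂ ℂ (fun _ : TSite d (fineP L m) => c₀) :
          SiteL2K ℂ d (fineP L m) c₀ W ≃ₗ[ℂ] (TSite d (fineP L m) → W)).symm f) y = 0 := by
    intro y hy
    have hne : UT.ofSite m (blockCoord L m y) ≠ v := fun h => hy ((ofSite_eq_iff _ _).1 h)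
    exact hfv y hne
  have hfF' : ∀ y, ‖WL2.equiv ℂ (fun _ : TSite d (fineP L m) => c₀) W
        ((WL2.linearEquiv ℂ ℂ (fun _ : TSite d (fineP L m) => c₀) :
          SiteL2K ℂ d (fineP L m) c₀ W ≃ₗ[ℂ] (TSite d (fineP L m) → W)).symm f) y‖ ≤ F :=
    fun y => hfF y
  have h := hB m (UT.one_le m) U hU hUε hRS (UT.toSite m v) _ F hfv' hfF' x
  exact le_of_eq_of_le rfl (h.trans_eq (by simp only [UT.toSite_ofSite]))

include hφ hφ' hMφ hMφ' hη hεU hc ha' hηL in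
/-- **THE `hG`-SHAPED LETTER WITH ONE CONSTANT FOR EVERY VOLUME AND EVERY BACKGROUND, in the geometry's own distance, operator as a
continuous linear map**: `∃ B ≥ 0` such that for EVERY coarse torus `m` and EVERY background `U` of the window on it,
`HasMaj S_m S_m ((𝒢_m.restrictScalars ℝ : 𝒴_m →ₗ[ℝ] 𝒴_m)) (B·e^{−(r/d)·d_m(y,v)})` with `𝒢_m := LinearMap.toContinuousLinearMap (e ∘ G′(U) ∘ e⁻¹)
: 𝒴_m →L[ℂ] 𝒴_m`, `𝒴_m := TSite d (fineP L m) → W` (sup norm, finite-dimensional) and `d_m = (toB6 (torusGeom m η₀ L₀ M₀) R H).dist = tdist1 m`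
(the ℓ¹ distance of the blocks; `d₁ ≤ d·d_∞` costs the rate `r ↦ r/d`) — LITERALLY the shape `fun y y' => B_G * Real.exp (-(ρ * g.dist y y'))`
of `B11SectG.hasMaj_comp_exp` and, token for token, the `hG` binder `HasMaj b3 bN (𝒢.restrictScalars ℝ : 𝒵 →ₗ[ℝ] 𝒴) (fun y y' => B_G *
Real.exp (-(δ₀ * g.dist y y')))` of `Beta/RemainderChartOriginDerivative.ineq190_fderiv_chartH179_zero_of_letters` (`𝒵 = 𝒴`, `b3 = bN = S_m`,
`B_G = B`, `δ₀ = r/d`), uniformly over a torus sequence `n ↦ m n` as a `Data190` record of row (D4) reads it.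
[cite: Balaban1985BackgroundPropagators, Thm 3.1 (3.42) p.397] [cite: Balaban1985Variational, (180) p.306, (182) p.307, (190) p.308] [cite: Balaban1984PropagatorsII, (2.51)–(2.52) p.232, (2.54) p.233] -/
theorem exists_hasMaj_GpOfU_uniform {γ β r : ℝ} (hγ : 0 < γ) (hβ : 0 ≤ β) (hr : 0 ≤ r)
    (hγc : γ ≤ 1 / (2 + 2 / a') -
        (Real.sqrt d * (‖((η : ℂ))⁻¹‖ * (2 * Mφ * Mφ' * εU)) + (Real.sqrt d * (‖((η : ℂ))⁻¹‖ * (2 * Mφ * Mφ' * εU))) ^ 2 +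
          a' * (((1 + 2 * Mφ * Mφ' * εU) ^ (d * (L - 1)) - 1)) * (2 + ((1 + 2 * Mφ * Mφ' * εU) ^ (d * (L - 1)) - 1))))
    {ℓ ℓ' : ℝ} (hℓ : 1 ≤ ℓ) (hℓ' : 1 ≤ ℓ') (hwin : r * ℓ * η ≤ 1) (hwin' : r * ℓ' ≤ 1)
    (hβD : 2 * r * ℓ * (Mφ * Mφ') * Real.sqrt d ≤ β) (hβQ : 2 * r * ℓ' * (1 + 2 * Mφ * Mφ' * εU) ^ (d * (L - 1)) ≤ β)
    (small : 3 * (1 + a') * β ^ 2 ≤ γ / 4) (hL : 1 ≤ L) :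
    ∃ B : ℝ, 0 ≤ B ∧ ∀ (m : Fin d → ℕ) [∀ i, NeZero (m i)] (U : Bond d (fineP L m) → 𝔸ˣ) (hU : ∀ b, U b ∈ U1 𝔸)
      (hUε : ∀ b, ‖(U b : 𝔸) - 1‖ ≤ εU)
      (hRS : ∀ (b : Bond d (fineP L m)) (v u : W), ⟪adTransportW φ U b v, u⟫_ℂ = ⟪v, adTransportW φ (fun b => (U b)⁻¹) b u⟫_ℂ),
      HasMaj
        (supSize (toB6 (torusGeom m η₀ L₀ M₀) R H)
          (fun y => Finset.univ.filter fun x : TSite d (fineP L m) => blockCoord L m x = UT.toSite m y)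
          (fun x => UT.ofSite m (blockCoord L m x)) : BlockNorm (toB6 (torusGeom m η₀ L₀ M₀) R H) (TSite d (fineP L m) → W))
        (supSize (toB6 (torusGeom m η₀ L₀ M₀) R H)
          (fun y => Finset.univ.filter fun x : TSite d (fineP L m) => blockCoord L m x = UT.toSite m y)
          (fun x => UT.ofSite m (blockCoord L m x)))
        (((LinearMap.toContinuousLinearMap
            ((WL2.linearEquiv ℂ ℂ (fun _ : TSite d (fineP L m) => c₀) :
                SiteL2K ℂ d (fineP L m) c₀ W ≃ₗ[ℂ] (TSite d (fineP L m) → W)).toLinearMap ∘ₗ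
              GpOfU L m φ η U a' (c₁ := c₁) (fun x hx => laplacePrimeA_pos_of_hRS L m φ η U a' hη.ne' ha' hRS x hx) ∘ₗ
              (WL2.linearEquiv ℂ ℂ (fun _ : TSite d (fineP L m) => c₀) :
                SiteL2K ℂ d (fineP L m) c₀ W ≃ₗ[ℂ] (TSite d (fineP L m) → W)).symm.toLinearMap)).restrictScalars ℝ :
            (TSite d (fineP L m) → W) →ₗ[ℝ] (TSite d (fineP L m) → W)))
        (fun y v => B * Real.exp (-(r / d * (toB6 (torusGeom m η₀ L₀ M₀) R H).dist y v))) := by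
  obtain ⟨B, hB0, hB⟩ :=
    exists_hasMaj_GpOfU_uniform_sup hφ hφ' hMφ hMφ' hη hεU hc ha' hηL η₀ L₀ M₀ R H hγ hβ hr hγc hℓ hℓ' hwin hwin' hβD hβQ
      small hL
  refine ⟨B, hB0, fun m _ U hU hUε hRS => ?_⟩
  exact ((hB m U hU hUε hRS).mono fun y v => mul_le_mul_of_nonneg_left (exp_tdist_le_exp_tdist1 hr y v) hB0).congr
    fun μ => rfl

end Uniform

/-! ## §3  One torus: the letter at fixed `m`, and (3.47)'s `L^∞` row as a constant majorant -/

section Torus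

variable {d : ℕ} {L : ℕ} [NeZero L] {m : Fin d → ℕ} [∀ i, NeZero (m i)]
  {𝔸 : Type*} [NormedRing 𝔸] [NormedAlgebra ℂ 𝔸] [NormOneClass 𝔸]
  {W : Type} [NormedAddCommGroup W] [InnerProductSpace ℂ W] [FiniteDimensional ℂ W] {φ : W ≃ₗ[ℂ] 𝔸} {Mφ Mφ' : ℝ}
  (hφ : ∀ w, ‖φ w‖ ≤ Mφ * ‖w‖) (hφ' : ∀ X, ‖φ.symm X‖ ≤ Mφ' * ‖X‖) (hMφ : 0 ≤ Mφ) (hMφ' : 0 ≤ Mφ')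
  {c₀ : ℝ} [Fact (0 < c₀)] {η : ℝ} (hη : 0 < η) {εU : ℝ} (hεU : 0 ≤ εU)
  {c₁ : ℝ} [Fact (0 < c₁)] (hc : c₁ = (L : ℝ) ^ d * c₀) {a' : ℝ} (ha' : 0 < a') (hηL : η * L = 1)
  (η₀ L₀ M₀ R : ℝ) (H : Prop)

include hφ hφ' hMφ hMφ' hη hεU hc ha' hηL in
/-- **THE `hG`-SHAPED LETTER ON ONE TORUS** (fixed `m`; the instance of `exists_hasMaj_GpOfU_uniform`): `∃ B ≥ 0`, for EVERY
background `U` of the window, `HasMaj S S ((𝒢.restrictScalars ℝ : 𝒴 →ₗ[ℝ] 𝒴)) (B·e^{−(r/d)·d(y,v)})`, `d = (toB6 (torusGeom m η₀ L₀ M₀) R H).dist`;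
the plain-composition form `(e ∘ G′(U) ∘ e⁻¹)↾ℝ` of the operator is the same map (`HasMaj.congr … fun _ => rfl`).
[cite: Balaban1985BackgroundPropagators, Thm 3.1 (3.42) p.397] [cite: Balaban1985Variational, (180) p.306, (190) p.308] [cite: Balaban1984PropagatorsII, (2.51)–(2.52) p.232, (2.54) p.233] -/
theorem exists_hasMaj_GpOfU {γ β r : ℝ} (hγ : 0 < γ) (hβ : 0 ≤ β) (hr : 0 ≤ r)
    (hγc : γ ≤ 1 / (2 + 2 / a') -
        (Real.sqrt d * (‖((η : ℂ))⁻¹‖ * (2 * Mφ * Mφ' * εU)) + (Real.sqrt d * (‖((η : ℂ))⁻¹‖ * (2 * Mφ * Mφ' * εU))) ^ 2 +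
          a' * (((1 + 2 * Mφ * Mφ' * εU) ^ (d * (L - 1)) - 1)) * (2 + ((1 + 2 * Mφ * Mφ' * εU) ^ (d * (L - 1)) - 1))))
    {ℓ ℓ' : ℝ} (hℓ : 1 ≤ ℓ) (hℓ' : 1 ≤ ℓ') (hwin : r * ℓ * η ≤ 1) (hwin' : r * ℓ' ≤ 1)
    (hβD : 2 * r * ℓ * (Mφ * Mφ') * Real.sqrt d ≤ β) (hβQ : 2 * r * ℓ' * (1 + 2 * Mφ * Mφ' * εU) ^ (d * (L - 1)) ≤ β)
    (small : 3 * (1 + a') * β ^ 2 ≤ γ / 4) (hL : 1 ≤ L) :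
    ∃ B : ℝ, 0 ≤ B ∧ ∀ (U : Bond d (fineP L m) → 𝔸ˣ) (hU : ∀ b, U b ∈ U1 𝔸) (hUε : ∀ b, ‖(U b : 𝔸) - 1‖ ≤ εU)
      (hRS : ∀ (b : Bond d (fineP L m)) (v u : W), ⟪adTransportW φ U b v, u⟫_ℂ = ⟪v, adTransportW φ (fun b => (U b)⁻¹) b u⟫_ℂ),
      HasMaj
        (supSize (toB6 (torusGeom m η₀ L₀ M₀) R H)
          (fun y => Finset.univ.filter fun x : TSite d (fineP L m) => blockCoord L m x = UT.toSite m y)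
          (fun x => UT.ofSite m (blockCoord L m x)) : BlockNorm (toB6 (torusGeom m η₀ L₀ M₀) R H) (TSite d (fineP L m) → W))
        (supSize (toB6 (torusGeom m η₀ L₀ M₀) R H)
          (fun y => Finset.univ.filter fun x : TSite d (fineP L m) => blockCoord L m x = UT.toSite m y)
          (fun x => UT.ofSite m (blockCoord L m x)))
        (((LinearMap.toContinuousLinearMap
            ((WL2.linearEquiv ℂ ℂ (fun _ : TSite d (fineP L m) => c₀) :
                SiteL2K ℂ d (fineP L m) c₀ W ≃ₗ[ℂ] (TSite d (fineP L m) → W)).toLinearMap ∘ₗ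
              GpOfU L m φ η U a' (c₁ := c₁) (fun x hx => laplacePrimeA_pos_of_hRS L m φ η U a' hη.ne' ha' hRS x hx) ∘ₗ
              (WL2.linearEquiv ℂ ℂ (fun _ : TSite d (fineP L m) => c₀) :
                SiteL2K ℂ d (fineP L m) c₀ W ≃ₗ[ℂ] (TSite d (fineP L m) → W)).symm.toLinearMap)).restrictScalars ℝ :
            (TSite d (fineP L m) → W) →ₗ[ℝ] (TSite d (fineP L m) → W)))
        (fun y v => B * Real.exp (-(r / d * (toB6 (torusGeom m η₀ L₀ M₀) R H).dist y v))) := by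
  obtain ⟨B, hB0, hB⟩ :=
    exists_hasMaj_GpOfU_uniform hφ hφ' hMφ hMφ' hη hεU hc ha' hηL η₀ L₀ M₀ R H hγ hβ hr hγc hℓ hℓ' hwin hwin' hβD hβQ small hL
  exact ⟨B, hB0, fun U hU hUε hRS => hB m U hU hUε hRS⟩

include hφ hφ' hMφ hMφ' hη hεU hc ha' hηL in
/-- **(3.47)'s ROW `|G′(U)λ|_∞ ≤ B₀|λ|_∞` AS A CONSTANT MAJORANT** (`0 < r`): on the same window there is ONE `B₀ ≥ 0` (theirs:
`C·e^{r}·√(L^d)·K_d(r)`) such that for EVERY background `U` of the window `HasMaj S S (G′(U)↾ℝ) (fun _ _ => B₀)` — the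
constant majorants of `B11SectG.hasMaj_comp_const`, from ne9-leaf-03's `exists_sup_row_GpOfU` by name.
[cite: Balaban1985BackgroundPropagators, Thm 3.1 (3.47) p.398, (3.42) p.397] [cite: Balaban1984PropagatorsII, (2.51)–(2.52) p.232] -/
theorem exists_hasMaj_GpOfU_const {γ β r : ℝ} (hγ : 0 < γ) (hβ : 0 ≤ β) (hr : 0 < r)
    (hγc : γ ≤ 1 / (2 + 2 / a') -
        (Real.sqrt d * (‖((η : ℂ))⁻¹‖ * (2 * Mφ * Mφ' * εU)) + (Real.sqrt d * (‖((η : ℂ))⁻¹‖ * (2 * Mφ * Mφ' * εU))) ^ 2 +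
          a' * (((1 + 2 * Mφ * Mφ' * εU) ^ (d * (L - 1)) - 1)) * (2 + ((1 + 2 * Mφ * Mφ' * εU) ^ (d * (L - 1)) - 1))))
    {ℓ ℓ' : ℝ} (hℓ : 1 ≤ ℓ) (hℓ' : 1 ≤ ℓ') (hwin : r * ℓ * η ≤ 1) (hwin' : r * ℓ' ≤ 1)
    (hβD : 2 * r * ℓ * (Mφ * Mφ') * Real.sqrt d ≤ β) (hβQ : 2 * r * ℓ' * (1 + 2 * Mφ * Mφ' * εU) ^ (d * (L - 1)) ≤ β)
    (small : 3 * (1 + a') * β ^ 2 ≤ γ / 4) (hL : 1 ≤ L) :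
    ∃ B₀ : ℝ, 0 ≤ B₀ ∧ ∀ (U : Bond d (fineP L m) → 𝔸ˣ) (hU : ∀ b, U b ∈ U1 𝔸) (hUε : ∀ b, ‖(U b : 𝔸) - 1‖ ≤ εU)
      (hRS : ∀ (b : Bond d (fineP L m)) (v u : W), ⟪adTransportW φ U b v, u⟫_ℂ = ⟪v, adTransportW φ (fun b => (U b)⁻¹) b u⟫_ℂ),
      HasMaj
        (supSize (toB6 (torusGeom m η₀ L₀ M₀) R H)
          (fun y => Finset.univ.filter fun x : TSite d (fineP L m) => blockCoord L m x = UT.toSite m y)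
          (fun x => UT.ofSite m (blockCoord L m x)) : BlockNorm (toB6 (torusGeom m η₀ L₀ M₀) R H) (TSite d (fineP L m) → W))
        (supSize (toB6 (torusGeom m η₀ L₀ M₀) R H)
          (fun y => Finset.univ.filter fun x : TSite d (fineP L m) => blockCoord L m x = UT.toSite m y)
          (fun x => UT.ofSite m (blockCoord L m x)))
        (((WL2.linearEquiv ℂ ℂ (fun _ : TSite d (fineP L m) => c₀) :
              SiteL2K ℂ d (fineP L m) c₀ W ≃ₗ[ℂ] (TSite d (fineP L m) → W)).toLinearMap ∘ₗ
            GpOfU L m φ η U a' (c₁ := c₁) (fun x hx => laplacePrimeA_pos_of_hRS L m φ η U a' hη.ne' ha' hRS x hx) ∘ₗ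
            (WL2.linearEquiv ℂ ℂ (fun _ : TSite d (fineP L m) => c₀) :
              SiteL2K ℂ d (fineP L m) c₀ W ≃ₗ[ℂ] (TSite d (fineP L m) → W)).symm.toLinearMap).restrictScalars ℝ)
        (fun _ _ => B₀) := by
  obtain ⟨B₀, hB0, hB⟩ :=
    exists_sup_row_GpOfU hφ hφ' hMφ hMφ' hη hεU hc ha' hηL hγ hβ hr hγc hℓ hℓ' hwin hwin' hβD hβQ small hL (UT.one_le m)
  refine ⟨B₀, hB0, fun U hU hUε hRS => ?_⟩
  refine hasMaj_supSize_const_of_sup (fun y x => mem_box_iff y x) _ hB0 ?_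
  intro f F hfF x
  have hfF' : ∀ y, ‖WL2.equiv ℂ (fun _ : TSite d (fineP L m) => c₀) W
        ((WL2.linearEquiv ℂ ℂ (fun _ : TSite d (fineP L m) => c₀) :
          SiteL2K ℂ d (fineP L m) c₀ W ≃ₗ[ℂ] (TSite d (fineP L m) → W)).symm f) y‖ ≤ F :=
    fun y => hfF y
  exact le_of_eq_of_le rfl (hB U hU hUε hRS _ F hfF' x)

end Torus

end Literature.MathematicalPhysics.QuantumFieldTheory.Balaban1983to89.Beta.RemainderHasMajGreenPrime

end
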